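import Mathlib.Analysis.InnerProductSpace.Laplacian
import Literature.Analysis.FluidPDE.SereginZajaczkowski2007
import HarnessLib

/-!
# Seregin–Zajaczkowski 2007, proof of Lemma 4.3: the swirl equation (4.15) as a named fact

G. Seregin, W. Zajaczkowski, *A sufficient condition of regularity for axially symmetric
solutions to the Navier–Stokes equations*, SIAM J. Math. Anal. 39 (2007) 669–685 =
arXiv:math/0702720, §4 (arXiv numbering). The proof of Lemma 4.3 (the swirl `L⁶` bound (4.14),
vendored as `OffAxisSwirlL6Bound` in `SereginZajaczkowski2007L6.lean`, reduced to the `L⁴`-energy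
bound (4.18) `SwirlL4EnergyBound` in `SereginZajaczkowski2007Swirl.lean`) opens with its only
PDE input:

> "We know that `V_φ` satisfies the equation
> `∂_t V_φ + V_ϱ V_{φ,ϱ} + V₃ V_{φ,3} + (1/ϱ) V_ϱ V_φ - (V_{φ,ϱϱ} + V_{φ,33} + (1/ϱ) V_{φ,ϱ} - (1/ϱ²) V_φ) = 0`."  (4.15)

Multiplying (4.15) by `ϱ` gives the equivalent equation for `α = ϱ V_φ` (the quantity the proof
actually works with, "`α = V_φ ϱ`"): `∂_t α + V_ϱ α_{,ϱ} + V₃ α_{,3} - (α_{,ϱϱ} + α_{,33} +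
(1/ϱ) α_{,ϱ}) + (2/ϱ) α_{,ϱ} = 0`, i.e., since `α` is axially symmetric (`α_{,φ} = 0`, so
`V·∇α = V_ϱ α_{,ϱ} + V₃ α_{,3}` and `Δα = α_{,ϱϱ} + (1/ϱ) α_{,ϱ} + α_{,33}`),

> `∂_t α + V·∇α - Δα + (2/ϱ) ∂_ϱ α = 0`  off the axis

— the swirl equation of axially symmetric Navier–Stokes flows (Koch–Nadirashvili–Seregin–Šverák
2009, (1.8): `Γ = r u_θ`; for classical solutions on `ℝ³ × S` it is the tree's discharged fact
`swirl_transport`, `swirl_transport_holds`, with `ν = 1`, `f = 0`).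

This file vendors (4.15), in this `α`-form, as the named fact `SwirlEquation` for the hypothesis
class of Prop. 4.1 (`IsSmoothAxisymmetricSolutionOn Q̃ V P`, `Q̃ = 𝒞(1/4, 3; 2) × ]-2², 0[`, parent
file `SereginZajaczkowski2007.lean`).

## Rendering choices

* `α = ϱ V_φ` is the accepted junk-free `swirl (V t) x = x₀ V₁ - x₁ V₀` (`= cylRadius x *
  swirlVelocity (V t) x` off the axis, `swirl_eq_cylRadius_mul_swirlVelocity`); every point of the
  shell `𝒞̃ = shell (1/4) 3 2` is off the axis, where the `α`-form and the printed `V_φ`-form are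
  equivalent.
* The class records no time regularity of `V` beyond the distributional equations (module
  docstring of the parent file), so — exactly as the accepted
  `KNSS2009_regularity_axisymmetric_swirl` renders KNSS (5.10) — the equation is stated in
  TIME-INTEGRATED form at each point: `α(t, x) - α(s, x) = ∫ₛᵗ (Δα - Dα[V] - (2/ϱ) ∂_ϱ α)(r, x) dr`
  for `x ∈ 𝒞̃` and `-2² < s ≤ t < 0`, with Mathlib's Laplacian `Δ` of the slice
  `swirl (V r) : ℝ³ → ℝ`, `Dα[V] = fderiv ℝ (swirl (V r)) x (V r x)` (`= V·∇α`) and the accepted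
  `partialDeriv (eR x)` (`= ∂_ϱ`). For the class the integrand is continuous in `r` (all spatial
  derivatives of `V` are continuous on `Q̃` in space–time), so this is (4.15) with a classical
  `∂_t`; its derivation from the distributional Navier–Stokes system (pair the momentum equation
  with `J x = ϱ e_φ`; the pressure of an axially symmetric solution is axially symmetric and drops
  out) is the content of the fact and is NOT done here.

## References

* G. Seregin, W. Zajaczkowski, SIAM J. Math. Anal. 39 (2007) 669–685, arXiv:math/0702720, §4,
  proof of Lemma 4.3: (4.15) and "`α = V_φ ϱ`". [`SereginZajaczkowski2007`]
* G. Koch, N. Nadirashvili, G. Seregin, V. Šverák, Acta Math. 203 (2009) 83–105 =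
  arXiv:0709.3599, (1.8) and (5.10) (the equation for `Γ = r u_θ`).
  [`KochNadirashviliSereginSverak2009`]
-/

noncomputable section

open MeasureTheory Set Function Filter Topology TopologicalSpace Metric
open scoped NNReal ENNReal ContDiff InnerProductSpace RealInnerProductSpace Laplacian

namespace Literature.Analysis.FluidPDE

namespace SereginZajaczkowski2007

open SereginSverak2009

/-- Local notation for physical space `ℝ³ = EuclideanSpace ℝ (Fin 3)`. -/
local notation "ℝ³" => EuclideanSpace ℝ (Fin 3)

/-- **Seregin–Zajaczkowski 2007, proof of Lemma 4.3, the swirl equation (4.15).** "We know that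
`V_φ` satisfies the equation `∂_t V_φ + V_ϱ V_{φ,ϱ} + V₃ V_{φ,3} + (1/ϱ) V_ϱ V_φ - (V_{φ,ϱϱ} +
V_{φ,33} + (1/ϱ) V_{φ,ϱ} - (1/ϱ²) V_φ) = 0`" (4.15), under the assumptions of Prop. 4.1 ("`V` and
`P` [are] a sufficiently smooth axially symmetric solution to the Navier–Stokes equations in
`Q̃ = 𝒞̃ × ]-2², 0[`, `𝒞̃ = 𝒞(1/4, 3; 2)`"). Rendered (module docstring) in the equivalent form for
`α = ϱ V_φ = swirl (V t)` ((4.15) multiplied by `ϱ`: `∂_t α + V·∇α - Δα + (2/ϱ) ∂_ϱ α = 0` off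
the axis, Koch–Nadirashvili–Seregin–Šverák 2009, (1.8)), integrated in time at each point of the
shell: for the accepted hypothesis class `IsSmoothAxisymmetricSolutionOn Q̃ V P`, every
`x ∈ 𝒞̃ = shell (1/4) 3 2` and all `-2² < s ≤ t < 0`,
`α(t, x) - α(s, x) = ∫ₛᵗ ((Δ α(r, ·))(x) - Dα(r, ·)(x)[V(r, x)] - (2/ϱ(x)) ∂_ϱ α(r, ·)(x)) dr`.
[cite: SereginZajaczkowski2007, proof of Lemma 4.3, (4.15)] -/
def SwirlEquation : Prop :=
  ∀ (V : ℝ → ℝ³ → ℝ³) (P : ℝ → ℝ³ → ℝ),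
    IsSmoothAxisymmetricSolutionOn (shellCylOpens (1 / 4) 3 2 2) V P →
    ∀ x ∈ shell (1 / 4) 3 2, ∀ s t : ℝ, -2 ^ 2 < s → s ≤ t → t < 0 →
      swirl (V t) x - swirl (V s) x =
        ∫ r in s..t, ((Δ (swirl (V r))) x - fderiv ℝ (swirl (V r)) x (V r x) -
          2 / cylRadius x * partialDeriv (eR x) (swirl (V r)) x)

/-- **Non-vacuity / sanity check**: the zero pair, which inhabits the hypothesis class
(`isSmoothAxisymmetricSolutionOn_zero`), satisfies the integrated swirl equation (all terms
vanish). [folklore] -/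
theorem swirlEquation_zero (x : ℝ³) (s t : ℝ) :
    swirl ((0 : ℝ → ℝ³ → ℝ³) t) x - swirl ((0 : ℝ → ℝ³ → ℝ³) s) x =
      ∫ r in s..t, ((Δ (swirl ((0 : ℝ → ℝ³ → ℝ³) r))) x -
        fderiv ℝ (swirl ((0 : ℝ → ℝ³ → ℝ³) r)) x ((0 : ℝ → ℝ³ → ℝ³) r x) -
          2 / cylRadius x * partialDeriv (eR x) (swirl ((0 : ℝ → ℝ³ → ℝ³) r)) x) := by
  have h0 : swirl (0 : ℝ³ → ℝ³) = fun _ => (0 : ℝ) := by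
    funext y
    simp [swirl]
  simp [h0]

end SereginZajaczkowski2007

end Literature.Analysis.FluidPDE
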